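import Summits.RiemannHypothesis.RiemannHypothesis.Theorems.TiltedLandingLaw421R3Lens1CoverageR
import Summits.RiemannHypothesis.RiemannHypothesis.Theorems.TiltedLandingLaw421R3Lens1CoverageB
import Summits.RiemannHypothesis.RiemannHypothesis.Theorems.TiltedLandingLaw421R3ClusterQMP
import Summits.RiemannHypothesis.RiemannHypothesis.Theorems.TiltedLandingLaw421R3LineageQ

/-! PROBE (not a module): S v2 body inlined + RS body, to certify that `CoverageRS-v1.lean` elaborates once `…R3Lens1SignCut` lands. -/


/-!
# W-08 · lens-1 gen 3 — MODULE S «SIGNED CUTS» v2: the hung-box door, the signed-corner door, the central lineage, and the residual `RegHungS`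

Cell rh-split, seat `rh33346-lens-1-g3` (LENS IDEATOR 1; lens = signed-Jensen boundary-sign census) for crux ⟨33346⟩ `TiltedLandingLaw421R`
(route EarlyAppointments), SUCC side.  SUPPORT only, typed over LANDED modules (`…R3Lens1CoverageB` #1135, `…R3ClusterQMP`, `…R3LineageQ`);
0 `sorry`, no new axioms, no instances, no notation.  HONEST LABEL: nothing here bears on the truth of RH; RH is NOT proved; models ≠ ξ;
⟨33346⟩/⟨33347⟩ stay OPEN (`RegHungS` below is an OPEN statement, a hypothesis of the compositions).

THE OBSERVATION.  The stop `ReadyR2 = CumReady (WindowReady ∨ TiltReady)` books, at every level `j' ≤ j`, every SIGNED window of `f^{(j')}`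
in the LAW's range carrying local A and a couple (seam 06 `WindowReady`; `SignWindow` = nine boundary-sign conjuncts ∧ `LocalA` ∧ couple).
Hence at a NON-Ready′ level ANY signed rectangle of `F = f^{(j)}` in range with a couple inside has ¬ local A for free: an off-axis zero `ρ` of
`f^{(j+1)}` IN THE OPEN BOX — no census, no Rolle identity, no NL event, no Jensen clearance (`offAxisZero_or_windowReady`).  By JENSEN'S
THEOREM at level `j` (tree `jensen_host_levelj`) `ρ` hangs in the closed disc of an upper zero `a` of `F`; if `a` is a level-`j` band point the
Jensen nesting `band_step'` puts `ρ` in the level-`(j+1)` band FOR FREE, so only OUT-OF-BAND hosts whose discs reach into the box need a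
clause (`HangClause`).  This is the HUNG-BOX door ★★★ `succ_or_readyR2_of_hungBox`; the tree's corner door `…R3ClusterQMP.succ_or_readyR2_of_
window_corners` (Jensen-CLEAR `Window` + corner inequality) is the special case `signedCorner_of_cornerWindow` + `hungBox_of_signedCorner`.
Signed ⊋ clear: signed cuts run THROUGH discs — beside a real zero («tooth») and on the midlines of a comb of any density.

CONTENTS.  §1 sockets `SignedRect`, `SignedCorner` · §2 `HangClause`, `HungBox`, ★★★ `succ_or_readyR2_of_hungBox`, `hangClause_of_inBand`
(in-band hosts free), `hangClause_of_corner` + `hungBox_of_signedCorner` ⇒ ★★ `succ_or_readyR2_of_signedCorner` · §3 `signedCorner_of_cornerWindow`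
(⊇ tree door A8) · §4 the free top (`jensenClear_of_gt_strip`: above the strip every point is Jensen-clear; `signedRect_of_cuts`: two vertical
transversals signed on heights `(0, Hs]` span a signed rectangle of height `Hs+1`) · §4b the CENTRAL LINEAGE (state-free): `ColCouple`,
`ColumnCuttable`, ★★ `succ_of_columnCuttable` (one level), ★★ `succ_of_columnCuttable_upTo` (from the booked pair `w₀`) · §5 the residual in
SUCCESSOR currency ★ `RegHungS` := (binders of `AntiEscapeCore` ∧ simple zero ∧ ¬F ∧ ¬N♭ ∧ ¬L-deep) ∧ ¬`HungBox` ⇒ successor,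
`antiEscapeCore_of_regHungS`, ★★ `TiltedLandingLaw421R_of_regHungS : RegHungS → RateLawsHalfQ → crux` (candidate v9q composition; with
`…R3Lens1CoverageR` landed, `RegHung9S` := binders of `RegRes8S` verbatim ∧ ¬`HungBox`).  ¬`HungBox` geometrically (NODE v10): every couple in
range is covered by the disc of an OUT-OF-BAND mate reaching below the level-`(j+1)` region, or edge-connected to such a disc / to the range
boundary through `{Im z · Im (F′/F)(z) ≥ 0}` — the «exile lens».
-/

namespace RhW08.Lens1SignCut

open Complex Set
open scoped ComplexConjugate
open Literature.Analysis.Complex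
open Summit.RiemannHypothesis.RiemannHypothesis.Theorems.Splittings.JensenWindow
open RhIdea6.G17.W07C7 RhIdea6.G17.W07C7.Rev6 RhIdea6.G18.W07C8.Law421BirthS RhIdea6.G19.W07C11.Seam
open RhIdea6.G20.W07C12.Frac RhIdea6.G20.W07C12.StColP RhW07.C12.FieldSplit RhIdea6.G21.W07C13.TentMax
open RhW07.C14.TwoSided RhW07.C14.Classes RhW07.C14.Lineage RhW07.C14.Booking
open RhW07.C13.Heredity RhIdea6.G22.W07C15pre.Injection RhW07.E3.Cell RhW07.E3.Lit
open RhW08.Round1 RhW08.StSwap RhW08.Round2 RhW08.QuadW RhW08.SealSwapQ RhW08.SealSwap RhW08.SuccB RhW08.SuccSplit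
open RhW08.SuccTheft RhW08.Column RhW08.Hurwitz RhW08.ClusterQ RhW08.ClusterQM RhW08.NewtonDoor RhW08.NewtonDoorGenusOne RhW08.PurseP
open RhW08.AntiEscapeSplit7 RhW08.Lens1Coverage RhW08.LineageQ

/-! ## §1 Signed rectangles and the signed-corner socket -/

/-- ★ SIGNED RECTANGLE `[α, β] × [−H, H]` for `F`: `α < β`, `0 < H`, `F·F′ ≠ 0` at the two real corners, and the Jensen–Kim boundary sign
`Im (F′/F) < 0` on the UPPER boundary (top edge `Im = H` over `[α, β]`, the two sides on heights `(0, H]`; the lower boundary follows by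
conjugation for real `F`).  These are exactly the first nine conjuncts of the seam's `SignWindow` (which adds `LocalA` and a couple). -/
def SignedRect (F : ℂ → ℂ) (α β H : ℝ) : Prop :=
  α < β ∧ 0 < H ∧ F α ≠ 0 ∧ F β ≠ 0 ∧ deriv F α ≠ 0 ∧ deriv F β ≠ 0 ∧
    (∀ x ∈ Icc α β, (deriv F ((x : ℂ) + (H : ℂ) * I) / F ((x : ℂ) + (H : ℂ) * I)).im < 0) ∧
    (∀ y ∈ Ioc (0 : ℝ) H, (deriv F ((α : ℂ) + (y : ℂ) * I) / F ((α : ℂ) + (y : ℂ) * I)).im < 0) ∧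
    (∀ y ∈ Ioc (0 : ℝ) H, (deriv F ((β : ℂ) + (y : ℂ) * I) / F ((β : ℂ) + (y : ℂ) * I)).im < 0)

/-- ★★ SOCKET «signed corner box at level `j`»: a signed rectangle of `f^{(j)}` with a couple inside whose two top corners satisfy the
level-`(j+1)` band inequality `(max(|α − x₀|, |β − x₀|) − R/2)₊² + (j+1)·min(H, Hs)² ≤ (j+1)·Hs²` — the tree's `CornerWindow`
(`…R3AntiEscapeSplit7`) with the Jensen-clear `Window` replaced by `SignedRect`. -/
def SignedCorner (f : ℂ → ℂ) (x₀ R Hs : ℝ) (j : ℕ) : Prop :=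
  ∃ α β H : ℝ, SignedRect (iteratedDeriv j f) α β H ∧
    (∃ u ∈ Ioo α β ×ℂ Ioo (-H) H, iteratedDeriv j f u = 0 ∧ u.im ≠ 0) ∧
    (max (max |α - x₀| |β - x₀| - R / 2) 0) ^ 2 + ((j : ℝ) + 1) * (min H Hs) ^ 2 ≤ ((j : ℝ) + 1) * Hs ^ 2

/-! ## §2 The doors: hung boxes and signed corners -/

/-- From `c · a < 0` and `0 < c`: `a < 0`. -/
private theorem neg_of_pos_mul_neg {c a : ℝ} (hc : 0 < c) (h : c * a < 0) : a < 0 :=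
  lt_of_not_ge fun h0 => absurd h (not_lt.2 (mul_nonneg hc.le h0))

/-- ★ A signed rectangle of `f^{(j)}` in the LAW's range WITH local A and a couple is a `WindowReady` datum at level `j` (seam 06). -/
theorem windowReady_of_signedRect {η : ℝ} {f : ℂ → ℂ} {x₀ s hmax R Hs : ℝ} {B j : ℕ} (v : ℂ) {α β H : ℝ}
    (hα : x₀ - ((j : ℝ) + 3) * R / 2 ≤ α) (hβ : β ≤ x₀ + ((j : ℝ) + 3) * R / 2) (hR : SignedRect (iteratedDeriv j f) α β H)
    (hA : LocalA (iteratedDeriv j f) α β H) (hJ : ∃ u ∈ Ioo α β ×ℂ Ioo (-H) H, iteratedDeriv j f u = 0 ∧ u.im ≠ 0) :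
    WindowReady η f x₀ s hmax R Hs B j v :=
  ⟨α, β, H, hα, hβ, hR.1, hR.2.1, hR.2.2.1, hR.2.2.2.1, hR.2.2.2.2.1, hR.2.2.2.2.2.1, hR.2.2.2.2.2.2.1,
    hR.2.2.2.2.2.2.2.1, hR.2.2.2.2.2.2.2.2, hA, hJ⟩

/-- ★★ THE DICHOTOMY.  A signed rectangle of `f^{(j)}` in range with a couple inside: EITHER an off-axis zero of `f^{(j+1)}` lies in the
OPEN box, OR the box is a `WindowReady` datum at level `j` (`by_cases LocalA`; no census, no Rolle identity, no NL event, no clearance). -/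
theorem offAxisZero_or_windowReady {η : ℝ} {f : ℂ → ℂ} {x₀ s hmax R Hs : ℝ} {B j : ℕ} (v : ℂ) {α β H : ℝ}
    (hα : x₀ - ((j : ℝ) + 3) * R / 2 ≤ α) (hβ : β ≤ x₀ + ((j : ℝ) + 3) * R / 2) (hR : SignedRect (iteratedDeriv j f) α β H)
    (hJ : ∃ u ∈ Ioo α β ×ℂ Ioo (-H) H, iteratedDeriv j f u = 0 ∧ u.im ≠ 0) :
    (∃ ρ ∈ Ioo α β ×ℂ Ioo (-H) H, iteratedDeriv (j + 1) f ρ = 0 ∧ ρ.im ≠ 0) ∨ WindowReady η f x₀ s hmax R Hs B j v := by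
  by_cases hA : LocalA (iteratedDeriv j f) α β H
  · exact Or.inr (windowReady_of_signedRect v hα hβ hR hA hJ)
  · exact Or.inl (Classical.byContradiction fun hno => hA fun ρ hρ hdρ =>
      Classical.byContradiction fun him => hno ⟨ρ, hρ, by rw [iteratedDeriv_succ]; exact hdρ, him⟩)

/-- ★ HANG CLAUSE of a box at level `j`: every point of the UPPER open box lying in the closed Jensen disc of an upper zero `a` of `F` satisfies
the level-`(j+1)` band inequality.  Free for hosts `a` that are level-`j` band points (`hangClause_of_inBand`, Jensen nesting `band_step'`) and
for boxes inside the level-`(j+1)` corner region (`hangClause_of_corner`); it only constrains OUT-OF-BAND hosts whose discs reach into the box. -/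
def HangClause (F : ℂ → ℂ) (x₀ R Hs : ℝ) (j : ℕ) (α β H : ℝ) : Prop :=
  ∀ a z : ℂ, F a = 0 → 0 < a.im → z ∈ Ioo α β ×ℂ Ioo 0 H → (z.re - a.re) ^ 2 + z.im ^ 2 ≤ a.im ^ 2 →
    (max (|z.re - x₀| - R / 2) 0) ^ 2 + ((j : ℝ) + 1) * z.im ^ 2 ≤ ((j : ℝ) + 1) * Hs ^ 2

/-- ★★ SOCKET «hung signed box at level `j`»: a signed rectangle of `f^{(j)}` in the LAW's range `|x − x₀| ≤ (j+3)R/2`, a couple inside, and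
the hang clause.  No corner inequality, no size restriction, mixed members allowed. -/
def HungBox (f : ℂ → ℂ) (x₀ R Hs : ℝ) (j : ℕ) : Prop :=
  ∃ α β H : ℝ, x₀ - ((j : ℝ) + 3) * R / 2 ≤ α ∧ β ≤ x₀ + ((j : ℝ) + 3) * R / 2 ∧ SignedRect (iteratedDeriv j f) α β H ∧
    (∃ u ∈ Ioo α β ×ℂ Ioo (-H) H, iteratedDeriv j f u = 0 ∧ u.im ≠ 0) ∧ HangClause (iteratedDeriv j f) x₀ R Hs j α β H

/-- ★★★ THE HUNG-BOX DOOR.  Legal frame, band state at level `j`, a hung signed box of `f^{(j)}` ⇒ a level-`(j+1)` band state OR `ReadyR2` at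
level `j`.  Proof: the dichotomy gives an off-axis zero `ρ` of `f^{(j+1)}` in the open box (or `WindowReady`); reflect it up; by JENSEN'S THEOREM
at level `j` (tree `jensen_host_levelj`) it hangs in the closed disc of an upper zero `a` of `f^{(j)}`; the hang clause puts it in the
level-`(j+1)` band (`succ_of_nonreal_zero_inBand`). -/
theorem succ_or_readyR2_of_hungBox {η : ℝ} {f : ℂ → ℂ} {x₀ s hmax R Hs : ℝ} {B j : ℕ} {v : ℂ}
    (hE : EngineHyps5 2 η f x₀ s hmax R Hs B) (hv : StTrkDQ η f x₀ s hmax R Hs B j v) (hB : HungBox f x₀ R Hs j) :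
    (∃ u : ℂ, StTrkDQ η f x₀ s hmax R Hs B (j + 1) u) ∨ ReadyR2 η f x₀ s hmax R Hs B j v := by
  obtain ⟨α, β, H, hα, hβ, hR, hJ, hH⟩ := hB
  rcases offAxisZero_or_windowReady v hα hβ hR hJ with ⟨ρ, hρ, hz, hρim⟩ | hW
  · left
    rw [mem_reProdIm] at hρ
    obtain ⟨u, hu, hup, hure, huim⟩ := exists_upper_zero_of_nonreal hE.1 hE.2.1 (j + 1) hz hρim
    obtain ⟨c, -, hc, -⟩ := hJ
    obtain ⟨a, ha, hapos, hdisc⟩ := jensen_host_levelj (realEntireLt2_of_hyps hE) j hv.1 hc hup hu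
    have huBox : u ∈ Ioo α β ×ℂ Ioo 0 H := by
      rw [mem_reProdIm, hure]
      refine ⟨hρ.1, hup, ?_⟩
      have : |u.im| < H := by rw [huim]; exact abs_lt.2 ⟨hρ.2.1, hρ.2.2⟩
      exact lt_of_le_of_lt (le_abs_self _) this
    exact succ_of_nonreal_zero_inBand hE hv hu hup.ne' (hH a u ha hapos huBox hdisc)
  · exact Or.inr (cumReady_of_ready (Ready := WinOrTilt) (Or.inl hW))

/-- ★ The `AntiEscapeCore`-shaped instance: at a non-Ready′ level a hung signed box yields the successor level. -/
theorem succ_of_hungBox {η : ℝ} {f : ℂ → ℂ} {x₀ s hmax R Hs : ℝ} {B j : ℕ} {v : ℂ}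
    (hE : EngineHyps5 2 η f x₀ s hmax R Hs B) (hv : StTrkDQ η f x₀ s hmax R Hs B j v) (hnR : ¬ ReadyR2 η f x₀ s hmax R Hs B j v)
    (hB : HungBox f x₀ R Hs j) : ∃ u : ℂ, StTrkDQ η f x₀ s hmax R Hs B (j + 1) u :=
  (succ_or_readyR2_of_hungBox hE hv hB).resolve_right hnR

/-- ★ In-band hosts hang for free: if every upper zero of `F = f^{(j)}` whose closed disc meets the upper open box satisfies the level-`j`
band inequality, the hang clause holds (Jensen nesting, tree `band_step'`; `Im a ≤ Hs` by strip heredity). -/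
theorem hangClause_of_inBand {η : ℝ} {f : ℂ → ℂ} {x₀ s hmax R Hs : ℝ} {B j : ℕ} (hE : EngineHyps5 2 η f x₀ s hmax R Hs B)
    (hnz : iteratedDeriv j f ≠ 0) {α β H : ℝ}
    (h : ∀ a : ℂ, iteratedDeriv j f a = 0 → 0 < a.im → (∃ z ∈ Ioo α β ×ℂ Ioo 0 H, (z.re - a.re) ^ 2 + z.im ^ 2 ≤ a.im ^ 2) →
      (max (|a.re - x₀| - R / 2) 0) ^ 2 + (j : ℝ) * a.im ^ 2 ≤ (j : ℝ) * Hs ^ 2) :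
    HangClause (iteratedDeriv j f) x₀ R Hs j α β H := by
  intro a z ha hapos hz hdisc
  have haHs : a.im ^ 2 ≤ Hs ^ 2 := by
    have h1 := abs_im_le_of_level hE hnz ha
    rw [abs_of_pos hapos] at h1
    nlinarith
  exact band_step' (h a ha hapos ⟨z, hz, hdisc⟩) haHs (by unfold NestedStep; linarith)

/-- The corner inequality puts the box base laterally inside the LAW's range: `max(|α − x₀|, |β − x₀|) < (j+3)R/2` (tree `range_of_lateral`). -/
theorem lateral_lt_of_corner {η : ℝ} {f : ℂ → ℂ} {x₀ s hmax R Hs : ℝ} {B j : ℕ} (hE : EngineHyps5 2 η f x₀ s hmax R Hs B)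
    {α β H : ℝ}
    (hcorner : (max (max |α - x₀| |β - x₀| - R / 2) 0) ^ 2 + ((j : ℝ) + 1) * (min H Hs) ^ 2 ≤ ((j : ℝ) + 1) * Hs ^ 2) :
    x₀ - ((j : ℝ) + 3) * R / 2 ≤ α ∧ β ≤ x₀ + ((j : ℝ) + 3) * R / 2 := by
  set M : ℝ := max |α - x₀| |β - x₀| with hMdef
  have hM0 : 0 ≤ M := le_trans (abs_nonneg _) (le_max_left _ _)
  have e : |(x₀ + M) - x₀| = M := by rw [show (x₀ + M) - x₀ = M by ring, abs_of_nonneg hM0]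
  have hlat : (max (|(x₀ + M) - x₀| + 0 - R / 2) 0) ^ 2 + ((j : ℝ) + 1) * (0 : ℝ) ^ 2 ≤ ((j : ℝ) + 1) * Hs ^ 2 := by
    rw [e, add_zero]
    have : 0 ≤ ((j : ℝ) + 1) * (min H Hs) ^ 2 := by positivity
    nlinarith
  have hrange := range_of_lateral (j := j) hE hlat
  rw [e, add_zero] at hrange
  have h1 : |α - x₀| ≤ M := le_max_left _ _
  have h2 : |β - x₀| ≤ M := le_max_right _ _
  exact ⟨by linarith [neg_abs_le (α - x₀)], by linarith [le_abs_self (β - x₀)]⟩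

/-- ★ Boxes inside the level-`(j+1)` corner region hang for free: the corner inequality implies the hang clause (monotonicity in `|Re − x₀|`,
`Im z ≤ Im a ≤ Hs` by strip heredity, `Im z < H`). -/
theorem hangClause_of_corner {η : ℝ} {f : ℂ → ℂ} {x₀ s hmax R Hs : ℝ} {B j : ℕ} (hE : EngineHyps5 2 η f x₀ s hmax R Hs B)
    (hnz : iteratedDeriv j f ≠ 0) {α β H : ℝ}
    (hcorner : (max (max |α - x₀| |β - x₀| - R / 2) 0) ^ 2 + ((j : ℝ) + 1) * (min H Hs) ^ 2 ≤ ((j : ℝ) + 1) * Hs ^ 2) :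
    HangClause (iteratedDeriv j f) x₀ R Hs j α β H := by
  intro a z ha hapos hz hdisc
  rw [mem_reProdIm] at hz
  have hsq : (max (|z.re - x₀| - R / 2) 0) ^ 2 ≤ (max (max |α - x₀| |β - x₀| - R / 2) 0) ^ 2 :=
    pow_le_pow_left₀ (le_max_right _ _) (max_le_max (by linarith [abs_sub_le_max_of_mem_Ioo (x₀ := x₀) hz.1]) le_rfl) 2
  have haHs : a.im ≤ Hs := by have h1 := abs_im_le_of_level hE hnz ha; rwa [abs_of_pos hapos] at h1
  have hza : z.im ≤ a.im := by nlinarith [hz.2.1, sq_nonneg (z.re - a.re)]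
  have hmin : z.im ≤ min H Hs := le_min hz.2.2.le (le_trans hza haHs)
  have him2 : z.im ^ 2 ≤ (min H Hs) ^ 2 := pow_le_pow_left₀ hz.2.1.le hmin 2
  have hj : (0 : ℝ) ≤ (j : ℝ) + 1 := by positivity
  nlinarith [mul_le_mul_of_nonneg_left him2 hj]

/-- ★ A signed corner box is a hung box (`lateral_lt_of_corner`, `hangClause_of_corner`). -/
theorem hungBox_of_signedCorner {η : ℝ} {f : ℂ → ℂ} {x₀ s hmax R Hs : ℝ} {B j : ℕ} (hE : EngineHyps5 2 η f x₀ s hmax R Hs B)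
    (hnz : iteratedDeriv j f ≠ 0) (hS : SignedCorner f x₀ R Hs j) : HungBox f x₀ R Hs j := by
  obtain ⟨α, β, H, hR, hJ, hcorner⟩ := hS
  obtain ⟨hα, hβ⟩ := lateral_lt_of_corner (j := j) (H := H) hE hcorner
  exact ⟨α, β, H, hα, hβ, hR, hJ, hangClause_of_corner hE hnz hcorner⟩

/-- ★★ THE SIGNED-CORNER DOOR (corollary).  Legal frame, band state at level `j`, a signed corner box of `f^{(j)}` ⇒ a level-`(j+1)` band state
OR `ReadyR2` at level `j`.  No census, no Rolle identity, no NL event, no Jensen clearance. -/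
theorem succ_or_readyR2_of_signedCorner {η : ℝ} {f : ℂ → ℂ} {x₀ s hmax R Hs : ℝ} {B j : ℕ} {v : ℂ}
    (hE : EngineHyps5 2 η f x₀ s hmax R Hs B) (hv : StTrkDQ η f x₀ s hmax R Hs B j v) (hS : SignedCorner f x₀ R Hs j) :
    (∃ u : ℂ, StTrkDQ η f x₀ s hmax R Hs B (j + 1) u) ∨ ReadyR2 η f x₀ s hmax R Hs B j v :=
  succ_or_readyR2_of_hungBox hE hv (hungBox_of_signedCorner hE hv.1 hS)

/-- ★ At a non-Ready′ level a signed corner box yields the successor level. -/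
theorem succ_of_signedCorner {η : ℝ} {f : ℂ → ℂ} {x₀ s hmax R Hs : ℝ} {B j : ℕ} {v : ℂ}
    (hE : EngineHyps5 2 η f x₀ s hmax R Hs B) (hv : StTrkDQ η f x₀ s hmax R Hs B j v) (hnR : ¬ ReadyR2 η f x₀ s hmax R Hs B j v)
    (hS : SignedCorner f x₀ R Hs j) : ∃ u : ℂ, StTrkDQ η f x₀ s hmax R Hs B (j + 1) u :=
  (succ_or_readyR2_of_signedCorner hE hv hS).resolve_right hnR

/-! ## §3 The signed door generalises the Jensen-clear corner door of the tree -/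

/-- `f^{(j)}` of a real entire `f` of order `< 2` is again real entire of order `< 2` (tree ingredients, as in `…R3ClusterQMP`). -/
theorem realEntireLt2_iteratedDeriv {f : ℂ → ℂ} (hf : RealEntireLt2 f) (j : ℕ) : RealEntireLt2 (iteratedDeriv j f) :=
  { diff := differentiable_iteratedDeriv_of_entire hf.diff j
    growth := hf.growth.elim fun _ h => h.elim fun _ h => exists_growth_iteratedDeriv hf.diff h.1 h.2.1 h.2.2 j
    real := im_iteratedDeriv_ofReal hf.diff hf.real j }

/-- At a Jensen-CLEAR off-axis point of `f^{(j)}` (with `f^{(j)}` having a zero) the boundary sign holds: `Im w · Im (F′/F)(w) < 0`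
(tree `im_mul_im_logDeriv_neg`, Kim 1996 (2.3)). -/
theorem sgn_of_jensenClear {f : ℂ → ℂ} (hf : RealEntireLt2 f) (j : ℕ) (hex : ∃ a, iteratedDeriv j f a = 0)
    {w : ℂ} (hw : w.im ≠ 0) (hc : JensenClear (iteratedDeriv j f) w) :
    w.im * (deriv (iteratedDeriv j f) w / iteratedDeriv j f w).im < 0 := by
  have hG := realEntireLt2_iteratedDeriv hf j
  obtain ⟨ρ, C, hρ0, hρ, hgr⟩ := hG.growth
  exact im_mul_im_logDeriv_neg hG.diff hρ0 hρ hgr hG.real hex hw hc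

/-- ★ A Jensen-clear `Window` of `f^{(j)}` (with `f^{(j)}` having a zero) is a signed rectangle. -/
theorem signedRect_of_window {f : ℂ → ℂ} (hf : RealEntireLt2 f) (j : ℕ) {α β H : ℝ}
    (hW : Window (iteratedDeriv j f) α β H) (hex : ∃ a, iteratedDeriv j f a = 0) :
    SignedRect (iteratedDeriv j f) α β H := by
  have imS : ∀ a y : ℝ, ((a : ℂ) + (y : ℂ) * I).im = y := by intro a y; simp
  have sgn : ∀ a y : ℝ, 0 < y → JensenClear (iteratedDeriv j f) ((a : ℂ) + (y : ℂ) * I) →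
      (deriv (iteratedDeriv j f) ((a : ℂ) + (y : ℂ) * I) / iteratedDeriv j f ((a : ℂ) + (y : ℂ) * I)).im < 0 := by
    intro a y hy hc
    have h1 := sgn_of_jensenClear hf j hex (w := (a : ℂ) + (y : ℂ) * I) (by rw [imS]; exact hy.ne') hc
    rw [imS] at h1
    exact neg_of_pos_mul_neg hy h1
  have hyI : ∀ y ∈ Ioc (0 : ℝ) H, y ∈ Icc (-H) H := fun y hy => ⟨by linarith [hy.1, hW.pos], hy.2⟩
  exact ⟨hW.lt, hW.pos, hW.fα, hW.fβ, hW.dα, hW.dβ, fun x hx => sgn x H hW.pos (hW.top x hx),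
    fun y hy => sgn α y hy.1 (hW.left y (hyI y hy) hy.1.ne'), fun y hy => sgn β y hy.1 (hW.right y (hyI y hy) hy.1.ne')⟩

/-- ★ `CornerWindow ⇒ SignedCorner` on a legal frame: the signed door contains the tree's corner-window door (A8 of `DoorAvailLawQ8`). -/
theorem signedCorner_of_cornerWindow {η : ℝ} {f : ℂ → ℂ} {x₀ s hmax R Hs : ℝ} {B j : ℕ} (hE : EngineHyps5 2 η f x₀ s hmax R Hs B)
    (hW : CornerWindow f x₀ R Hs j) : SignedCorner f x₀ R Hs j := by
  obtain ⟨α, β, h, hWin, hJ, hcorner⟩ := hW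
  have hex : ∃ a, iteratedDeriv j f a = 0 := hJ.elim fun u hu => ⟨u, hu.2.1⟩
  exact ⟨α, β, h, signedRect_of_window (realEntireLt2_of_hyps hE) j hWin hex, hJ, hcorner⟩

/-! ## §4 The free top: column transversals -/

/-- Above the strip every point is Jensen-clear for `f^{(j)}`: all zeros of `f^{(j)} ≢ 0` have `|Im| ≤ Hs` (strip heredity
`abs_im_le_of_level`), and `|Im w| ≤ ‖w − Re a‖`. -/
theorem jensenClear_of_gt_strip {η : ℝ} {f : ℂ → ℂ} {x₀ s hmax R Hs : ℝ} {B j : ℕ} (hE : EngineHyps5 2 η f x₀ s hmax R Hs B)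
    (hnz : iteratedDeriv j f ≠ 0) {w : ℂ} (hw : Hs < |w.im|) : JensenClear (iteratedDeriv j f) w := by
  intro a ha _
  have h1 : |a.im| ≤ Hs := abs_im_le_of_level hE hnz ha
  have h3 := Complex.abs_im_le_norm (w - (a.re : ℂ))
  rw [show (w - (a.re : ℂ)).im = w.im by simp] at h3
  linarith

/-- ★ Two vertical transversals `α < β` signed on heights `(0, Hs]` with `F·F′ ≠ 0` at their feet span a signed rectangle of height
`Hs + 1`: the top edge and the side segments above the strip are signed for free (`jensenClear_of_gt_strip`). -/
theorem signedRect_of_cuts {η : ℝ} {f : ℂ → ℂ} {x₀ s hmax R Hs : ℝ} {B j : ℕ} (hE : EngineHyps5 2 η f x₀ s hmax R Hs B)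
    (hnz : iteratedDeriv j f ≠ 0) (hex : ∃ a, iteratedDeriv j f a = 0) {α β : ℝ} (hlt : α < β)
    (hFα : iteratedDeriv j f α ≠ 0) (hFβ : iteratedDeriv j f β ≠ 0)
    (hdα : deriv (iteratedDeriv j f) α ≠ 0) (hdβ : deriv (iteratedDeriv j f) β ≠ 0)
    (hsα : ∀ y ∈ Ioc (0 : ℝ) Hs,
      (deriv (iteratedDeriv j f) ((α : ℂ) + (y : ℂ) * I) / iteratedDeriv j f ((α : ℂ) + (y : ℂ) * I)).im < 0)
    (hsβ : ∀ y ∈ Ioc (0 : ℝ) Hs,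
      (deriv (iteratedDeriv j f) ((β : ℂ) + (y : ℂ) * I) / iteratedDeriv j f ((β : ℂ) + (y : ℂ) * I)).im < 0) :
    SignedRect (iteratedDeriv j f) α β (Hs + 1) := by
  have hH : 0 < Hs + 1 := by linarith [hE.2.2.2.2.2.2.2.1]
  have imS : ∀ a y : ℝ, ((a : ℂ) + (y : ℂ) * I).im = y := by intro a y; simp
  have sgn : ∀ a y : ℝ, Hs < y →
      (deriv (iteratedDeriv j f) ((a : ℂ) + (y : ℂ) * I) / iteratedDeriv j f ((a : ℂ) + (y : ℂ) * I)).im < 0 := by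
    intro a y hy
    have hy0 : 0 < y := lt_of_le_of_lt hE.2.2.2.2.2.2.2.1 hy
    have h1 := sgn_of_jensenClear (realEntireLt2_of_hyps hE) j hex (w := (a : ℂ) + (y : ℂ) * I) (by rw [imS]; exact hy0.ne')
      (jensenClear_of_gt_strip hE hnz (by rw [imS, abs_of_pos hy0]; exact hy))
    rw [imS] at h1
    exact neg_of_pos_mul_neg hy0 h1
  have side : ∀ a : ℝ,
      (∀ y ∈ Ioc (0 : ℝ) Hs, (deriv (iteratedDeriv j f) ((a : ℂ) + (y : ℂ) * I) / iteratedDeriv j f ((a : ℂ) + (y : ℂ) * I)).im < 0) →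
      ∀ y ∈ Ioc (0 : ℝ) (Hs + 1),
        (deriv (iteratedDeriv j f) ((a : ℂ) + (y : ℂ) * I) / iteratedDeriv j f ((a : ℂ) + (y : ℂ) * I)).im < 0 := by
    intro a hs y hy
    by_cases hyle : y ≤ Hs
    · exact hs y ⟨hy.1, hyle⟩
    · exact sgn a y (lt_of_not_ge hyle)
  exact ⟨hlt, hH, hFα, hFβ, hdα, hdβ, fun x _ => sgn x (Hs + 1) (by linarith), side α hsα, side β hsβ⟩

/-- A zero of `f^{(j)} ≢ 0` with `α < Re u < β` lies in the open box `(α, β) × (−(Hs+1), Hs+1)` (strip heredity). -/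
theorem mem_box_of_zero {η : ℝ} {f : ℂ → ℂ} {x₀ s hmax R Hs : ℝ} {B j : ℕ} (hE : EngineHyps5 2 η f x₀ s hmax R Hs B)
    (hnz : iteratedDeriv j f ≠ 0) {u : ℂ} (hu : iteratedDeriv j f u = 0) {α β : ℝ} (huα : α < u.re) (huβ : u.re < β) :
    u ∈ Ioo α β ×ℂ Ioo (-(Hs + 1)) (Hs + 1) := by
  have huHs : |u.im| ≤ Hs := abs_im_le_of_level hE hnz hu
  rw [mem_reProdIm]
  exact ⟨⟨huα, huβ⟩, by linarith [neg_abs_le u.im], by linarith [le_abs_self u.im]⟩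

/-! ## §4b The central lineage: column-cuttable levels propagate a column couple (state-free, `v`-free) -/

/-- A COLUMN COUPLE at level `j`: an off-axis zero of `f^{(j)}` with real part inside the open column `|Re − x₀| < R/2`.  At level 0 the
frame's booked pair `w₀` (`Re w₀ = x₀`) is one. -/
def ColCouple (f : ℂ → ℂ) (x₀ R : ℝ) (j : ℕ) : Prop :=
  ∃ c : ℂ, iteratedDeriv j f c = 0 ∧ c.im ≠ 0 ∧ |c.re - x₀| < R / 2

/-- ★ SOCKET «level `j` is COLUMN-CUTTABLE»: every column couple `c` of `F = f^{(j)}` is bracketed, inside the closed column, by two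
vertical transversals `α < Re c < β` signed on heights `(0, Hs]` with `F·F′ ≠ 0` at their feet.  (Fails iff some column couple is
edge-connected, through the set where the boundary sign fails at some height `≤ Hs`, to a column wall `Re = x₀ ± R/2`.) -/
def ColumnCuttable (f : ℂ → ℂ) (x₀ R Hs : ℝ) (j : ℕ) : Prop :=
  ∀ c : ℂ, iteratedDeriv j f c = 0 → c.im ≠ 0 → |c.re - x₀| < R / 2 →
    ∃ α β : ℝ, x₀ - R / 2 ≤ α ∧ β ≤ x₀ + R / 2 ∧ α < c.re ∧ c.re < β ∧
      iteratedDeriv j f α ≠ 0 ∧ iteratedDeriv j f β ≠ 0 ∧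
      deriv (iteratedDeriv j f) α ≠ 0 ∧ deriv (iteratedDeriv j f) β ≠ 0 ∧
      (∀ y ∈ Ioc (0 : ℝ) Hs, (deriv (iteratedDeriv j f) ((α : ℂ) + (y : ℂ) * I) / iteratedDeriv j f ((α : ℂ) + (y : ℂ) * I)).im < 0) ∧
      (∀ y ∈ Ioc (0 : ℝ) Hs, (deriv (iteratedDeriv j f) ((β : ℂ) + (y : ℂ) * I) / iteratedDeriv j f ((β : ℂ) + (y : ℂ) * I)).im < 0)

/-- ★ LINEAGE STEP: legal frame, `f^{(j)} ≢ 0`, a column couple at level `j`, level `j` column-cuttable and NOT `WindowReady` ⇒ a column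
couple at level `j+1` (the off-axis zero of `f^{(j+1)}` that ¬ local A puts in the open cut box, `offAxisZero_or_windowReady`). -/
theorem colCouple_succ_of_cuttable {η : ℝ} {f : ℂ → ℂ} {x₀ s hmax R Hs : ℝ} {B j : ℕ} (v : ℂ)
    (hE : EngineHyps5 2 η f x₀ s hmax R Hs B) (hnz : iteratedDeriv j f ≠ 0) (hP : ColCouple f x₀ R j)
    (hcut : ColumnCuttable f x₀ R Hs j) (hnW : ¬ WindowReady η f x₀ s hmax R Hs B j v) : ColCouple f x₀ R (j + 1) := by
  obtain ⟨c, hc, hcim, hccol⟩ := hP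
  obtain ⟨α, β, hα, hβ, hαc, hcβ, hFα, hFβ, hdα, hdβ, hsα, hsβ⟩ := hcut c hc hcim hccol
  have hlt : α < β := lt_trans hαc hcβ
  have hH : 0 < Hs + 1 := by linarith [hE.2.2.2.2.2.2.2.1]
  have hR := signedRect_of_cuts hE hnz ⟨c, hc⟩ hlt hFα hFβ hdα hdβ hsα hsβ
  have hJ : ∃ u ∈ Ioo α β ×ℂ Ioo (-(Hs + 1)) (Hs + 1), iteratedDeriv j f u = 0 ∧ u.im ≠ 0 :=
    ⟨c, mem_box_of_zero hE hnz hc hαc hcβ, hc, hcim⟩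
  obtain ⟨hα', hβ'⟩ := lateral_lt_of_corner (j := j) (H := Hs + 1) hE (corner_of_columnBase (j := j) hlt hH hα hβ)
  rcases offAxisZero_or_windowReady v hα' hβ' hR hJ with ⟨ρ, hρ, hz, hρim⟩ | hW
  · rw [mem_reProdIm] at hρ
    exact ⟨ρ, hz, hρim, abs_lt.2 ⟨by linarith [hρ.1.1], by linarith [hρ.1.2]⟩⟩
  · exact absurd hW hnW

/-- ★★ COLUMN-CUT DOOR (one level, state-free): legal frame, level `j` not Ready′, a column couple at level `j`, level `j` column-cuttable ⇒
the level-`(j+1)` band is inhabited (the propagated column couple is a band state by column immunity `stTrkDQ_of_column`). -/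
theorem succ_of_columnCuttable {η : ℝ} {f : ℂ → ℂ} {x₀ s hmax R Hs : ℝ} {B j : ℕ} (v : ℂ)
    (hE : EngineHyps5 2 η f x₀ s hmax R Hs B) (hnR : ¬ ReadyR2 η f x₀ s hmax R Hs B j v) (hP : ColCouple f x₀ R j)
    (hcut : ColumnCuttable f x₀ R Hs j) : ∃ u : ℂ, StTrkDQ η f x₀ s hmax R Hs B (j + 1) u := by
  have hnz := iteratedDeriv_ne_zero_of_not_readyR2 hE j v hnR
  have hnW : ¬ WindowReady η f x₀ s hmax R Hs B j v := fun hW => hnR (cumReady_of_ready (Ready := WinOrTilt) (Or.inl hW))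
  obtain ⟨c, hc, hcim, hccol⟩ := colCouple_succ_of_cuttable v hE hnz.1 hP hcut hnW
  obtain ⟨u, hu, hup, hure, -⟩ := exists_upper_zero_of_nonreal hE.1 hE.2.1 (j + 1) hc hcim
  exact ⟨u, stTrkDQ_of_column hE hnz.2 hu hup (by rw [hure]; exact hccol.le)⟩

/-- ★★ THE CENTRAL-LINEAGE DOOR (state-free).  Legal frame, level `j` not Ready′, every level `j' ≤ j` column-cuttable ⇒ the level-`(j+1)` band
is inhabited: induction from the booked pair `w₀` (a column couple at level 0) via `colCouple_succ_of_cuttable`, then `succ_of_columnCuttable`. -/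
theorem succ_of_columnCuttable_upTo {η : ℝ} {f : ℂ → ℂ} {x₀ s hmax R Hs : ℝ} {B j : ℕ} (v : ℂ)
    (hE : EngineHyps5 2 η f x₀ s hmax R Hs B) (hnR : ¬ ReadyR2 η f x₀ s hmax R Hs B j v)
    (hcut : ∀ j', j' ≤ j → ColumnCuttable f x₀ R Hs j') : ∃ u : ℂ, StTrkDQ η f x₀ s hmax R Hs B (j + 1) u := by
  have hRpos : 0 < R := R_pos_of_engine hE
  have P : ∀ k, k ≤ j → ColCouple f x₀ R k := by
    intro k
    induction k with
    | zero =>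
      intro _
      obtain ⟨w₀, hw₀, hw₀im, hw₀re, -⟩ := hE.2.2.2.2.2.2.2.2.2.2.1
      exact ⟨w₀, by rw [iteratedDeriv_zero]; exact hw₀, hw₀im, by rw [hw₀re, sub_self, abs_zero]; linarith⟩
    | succ k ih =>
      intro hk
      have hnRk : ¬ ReadyR2 η f x₀ s hmax R Hs B k v := fun h => hnR (readyR2_mono h (by omega))
      have hnW : ¬ WindowReady η f x₀ s hmax R Hs B k v := fun hW => hnRk (cumReady_of_ready (Ready := WinOrTilt) (Or.inl hW))
      exact colCouple_succ_of_cuttable v hE (iteratedDeriv_ne_zero_of_not_readyR2 hE k v hnRk).1 (ih (by omega)) (hcut k (by omega)) hnW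
  exact succ_of_columnCuttable v hE hnR (P j le_rfl) (hcut j le_rfl)

/-! ## §5 The residuals in SUCCESSOR currency and the compositions -/

/-- ★ THE HUNG RESIDUAL `RegHungS` (OPEN; successor currency; the candidate v9q SUCC stub).  On a legal frame, at a level `j` whose lowest band
state `v` is not Ready′, not in an all-in-band window, undimpled, disc-overlapped, a simple zero, outside the proved cells F / N♭ / L-deep of
`…R3Lens1CoverageB`, and such that `f^{(j)}` admits NO hung signed box at level `j` (¬ `HungBox`), a level-`(j+1)` band state still exists.
WHY IT MIGHT FAIL: the «exile lens» — `v` laterally saturated, covered by the disc of a taller OUT-OF-BAND mate with no real zero between,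
children nested under the mate only.  (With `…R3Lens1CoverageR` landed, `RegHung9S` adds the binders `¬ LandingDipW`, `¬ IsolatedNewtonL`.) -/
def RegHungS : Prop :=
  ∀ (η : ℝ) (f : ℂ → ℂ) (x₀ s hmax R Hs : ℝ) (B : ℕ), EngineHyps5 2 η f x₀ s hmax R Hs B → ∀ (j : ℕ) (v : ℂ),
    IsLowest StTrkDQ η f x₀ s hmax R Hs B j v → ¬ ReadyR2 η f x₀ s hmax R Hs B j v →
    ¬ AllInBandInRangeWindow f x₀ R Hs j v → ¬ Dimple f j v → DiscOverlap f j v →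
    iteratedDeriv (j + 1) f v ≠ 0 → ¬ CellF f j v → ¬ CellNb f x₀ R Hs j v → ¬ LandingDipDeep f x₀ R Hs j v →
    ¬ HungBox f x₀ R Hs j →
    ∃ u : ℂ, StTrkDQ η f x₀ s hmax R Hs B (j + 1) u

/-- ★★ COVERAGE BY HUNG BOXES, SUCCESSOR CURRENCY: the hung residual closes `AntiEscapeCore` (multiple zero: `succ_of_multiple`; cells F, N♭,
L-deep: the proved regime lemmas of `…R3Lens1CoverageB`; a hung signed box: `succ_of_hungBox`; else `RegHungS`). -/
theorem antiEscapeCore_of_regHungS (hC : RegHungS) : AntiEscapeCore := by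
  intro η f x₀ s hmax R Hs B hE j v hlow hnR hwin hdim hov
  by_cases hz : iteratedDeriv (j + 1) f v = 0
  · exact succ_of_multiple hE hlow.1 hz
  by_cases hF : CellF f j v
  · exact regime_F hE hlow.1 hF
  by_cases hN : CellNb f x₀ R Hs j v
  · exact regime_Nb hE hlow.1 hN
  by_cases hD : LandingDipDeep f x₀ R Hs j v
  · exact regime_Ldeep hE hD
  by_cases hB : HungBox f x₀ R Hs j
  · exact succ_of_hungBox hE hlow.1 hnR hB
  exact hC η f x₀ s hmax R Hs B hE j v hlow hnR hwin hdim hov hz hF hN hD hB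

/-- (K) `RegHungS ⇒ RestSuccBotQ` (tree `restSuccBotQ_of_pieces` + `antiEscape_of_core`). -/
theorem restSuccBotQ_of_regHungS (hC : RegHungS) : RestSuccBotQ :=
  restSuccBotQ_of_pieces dimpleSig_holds (antiEscape_of_core (antiEscapeCore_of_regHungS hC))

/-- ★★ THE CRUX BY NAME from the hung residual and lens-2's rate law (candidate v9q composition: stubs `RegHungS`, `RateLawsHalfQ`). -/
theorem TiltedLandingLaw421R_of_regHungS (hC : RegHungS) (hR : RhW08.RateSplit.RateLawsHalfQ) :
    Summit.RiemannHypothesis.RiemannHypothesis.Theses.EarlyAppointments.TiltedLandingLaw421R :=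
  law421Half_of_succ_rate (restSuccBotQ_of_regHungS hC) (RhW08.RateSplit.restRateBotPQ_half_of_rateLaws hR)

end RhW08.Lens1SignCut


/-!
# Lens-1 file RS (v9q image helper): the SUCC stub `RegHung9S` := binders of `RegRes8S` VERBATIM ∧ ¬`HungBox` ⇒ successor, and its compositions

UNCHECKED DRAFT until its two imports land (`…R3Lens1CoverageR` = `lens-1/Coverage-landable-v1R-v3.lean` 5e4f5aaf, `…R3Lens1SignCut` =
`lens-1/SignCut-v2.lean` 0a8482f7); then `lean check` must give rc 0 · 0 sorry · STD axioms (lens-1 or the lead runs it the hour R lands, (CA484)(2)).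
Declares `RegHung9S` (the v9q SUCC stub: every binder and exclusion of `RegRes8S` verbatim, plus ¬`RhW08.Lens1SignCut.HungBox f x₀ R Hs j`),
`regHung9S_of_regRes8S` (never stronger than the v8q stub), `regHung9S_of_regHungS` (implied by module S's landed-name residual),
`regRes8S_of_regHung9S` (the hung-box door `succ_of_hungBox` discharges the new binder), and
`TiltedLandingLaw421R_of_regHung9S : RegHung9S → RhW08.RateSplit.RateLawsHalfQ → crux` BY NAME.
0 sorry.  Nothing here bears on the truth of RH; RH is not proved; ⟨33346⟩/⟨33347⟩ stay OPEN (`RegHung9S` and `RateLawsHalfQ` are hypotheses). -/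

namespace RhW08.Lens1Coverage

set_option linter.dupNamespace false

open Complex Set
open scoped ComplexConjugate
open Literature.Analysis.Complex
open Summit.RiemannHypothesis.RiemannHypothesis.Theorems.Splittings.JensenWindow
open RhIdea6.G17.W07C7 RhIdea6.G17.W07C7.Rev6 RhIdea6.G18.W07C8.Law421BirthS RhIdea6.G19.W07C11.Seam
open RhIdea6.G20.W07C12.Frac RhIdea6.G20.W07C12.StColP RhW07.C12.FieldSplit RhIdea6.G21.W07C13.TentMax
open RhW07.C14.TwoSided RhW07.C14.Classes RhW07.C14.Lineage RhW07.C14.Booking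
open RhW07.C13.Heredity RhIdea6.G22.W07C15pre.Injection RhW07.E3.Cell RhW07.E3.Lit
open RhW08.Round1 RhW08.StSwap RhW08.Round2 RhW08.QuadW RhW08.SealSwapQ RhW08.SealSwap RhW08.SuccB RhW08.SuccSplit
open RhW08.SuccTheft RhW08.Column RhW08.Hurwitz RhW08.ClusterQ RhW08.ClusterQM RhW08.NewtonDoor RhW08.NewtonDoorGenusOne RhW08.PurseP
open RhW08.AntiEscapeSplit7

open RhW08.Lens1SignCut

/-- ★ THE v9q SUCC STUB `RegHung9S` (OPEN): the binders and exclusions of `RegRes8S` verbatim, plus «`f^{(j)}` admits no hung signed box at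
level `j`» (¬ `HungBox`, module S) ⇒ a level-`(j+1)` band state.  WHY IT MIGHT FAIL: the exile lens (NODE v10 §4). -/
def RegHung9S : Prop :=
  ∀ (η : ℝ) (f : ℂ → ℂ) (x₀ s hmax R Hs : ℝ) (B : ℕ), EngineHyps5 2 η f x₀ s hmax R Hs B → ∀ (j : ℕ) (v : ℂ),
    IsLowest StTrkDQ η f x₀ s hmax R Hs B j v → ¬ ReadyR2 η f x₀ s hmax R Hs B j v →
    ¬ AllInBandInRangeWindow f x₀ R Hs j v → ¬ Dimple f j v → DiscOverlap f j v →
    iteratedDeriv (j + 1) f v ≠ 0 →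
    ¬ CellF f j v → ¬ CellNb f x₀ R Hs j v → ¬ LandingDipDeep f x₀ R Hs j v → ¬ LandingDipW f x₀ R Hs j v →
    ¬ IsolatedNewtonL f x₀ R Hs j v → ¬ HungBox f x₀ R Hs j → ∃ u : ℂ, StTrkDQ η f x₀ s hmax R Hs B (j + 1) u

/-- Monotonicity: the v8q stub `RegRes8S` implies `RegHung9S` (one more hypothesis, ignored). -/
theorem regHung9S_of_regRes8S (hX : RegRes8S) : RegHung9S :=
  fun η f x₀ s hmax R Hs B hE j v hlow hnR hwin hdim hov hz hnF hnNb hnD hnW hnI _ =>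
    hX η f x₀ s hmax R Hs B hE j v hlow hnR hwin hdim hov hz hnF hnNb hnD hnW hnI

/-- Monotonicity: module S's landed-name residual `RegHungS` implies `RegHung9S` (two more hypotheses, ignored). -/
theorem regHung9S_of_regHungS (hX : RegHungS) : RegHung9S :=
  fun η f x₀ s hmax R Hs B hE j v hlow hnR hwin hdim hov hz hnF hnNb hnD _ _ hB =>
    hX η f x₀ s hmax R Hs B hE j v hlow hnR hwin hdim hov hz hnF hnNb hnD hB

/-- ★ The hung-box door discharges the new binder: `RegHung9S ⇒ RegRes8S` (`RhW08.Lens1SignCut.succ_of_hungBox`). -/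
theorem regRes8S_of_regHung9S (hX : RegHung9S) : RegRes8S := by
  intro η f x₀ s hmax R Hs B hE j v hlow hnR hwin hdim hov hz hnF hnNb hnD hnW hnI
  by_cases hB : HungBox f x₀ R Hs j
  · exact succ_of_hungBox hE hlow.1 hnR hB
  exact hX η f x₀ s hmax R Hs B hE j v hlow hnR hwin hdim hov hz hnF hnNb hnD hnW hnI hB

/-- ★★ THE CRUX BY NAME from the v9q stubs (`RegHung9S`, lens-2's `RateLawsHalfQ`), via `TiltedLandingLaw421R_of_resS`. -/
theorem TiltedLandingLaw421R_of_regHung9S (hX : RegHung9S) (hR : RhW08.RateSplit.RateLawsHalfQ) :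
    Summit.RiemannHypothesis.RiemannHypothesis.Theses.EarlyAppointments.TiltedLandingLaw421R :=
  TiltedLandingLaw421R_of_resS (regRes8S_of_regHung9S hX) hR

end RhW08.Lens1Coverage
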